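import Summits.QuantumFields.YangMills.Theorems.BalabanUVNodesN13NormalisationUpperSlopeThresholdAtRecord13SepCoPHV
import Summits.QuantumFields.YangMills.Theorems.BalabanUVNodesK2R9Holds

/-!
# BalabanUVNodes ∕ N13 — K1⁹'s WITNESS HAS NORMALISATION SLOPE AT MOST d(𝔤)∕4 (modulo the small-field floor): the body of `StabilityBRunRowsAtRecordR13SepCoPHV` (stmt-QuantumFields-27364) is
# FALSE at every tuple whose numerics slots have log-slope at least `a` with `4a > d(𝔤)` and whose last-step small-field mass has a K-uniform floor at each small renormalised coupling — K2⁹ by name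
# supplies END from the rows, row (iv) supplies the coupling comparability

(Track A, DAG node N13 = [B16]; cluster K1 — helper for K1⁹ stmt-QuantumFields-27364; seat `pub-ymgap-dag-n13-w3` g6, INTENT-5; 2026-08-28; count-neutral; theses cone: imports
`…Theorems.BalabanUVNodesK2R9Holds`.)  The mirror of p641922 (`…N13K1R9WitnessSlopeThreshold`, lower threshold).  Cone-side reading of
`…N13NormalisationUpperSlopeThresholdAtRecord13SepCoPHV.false_of_endStatementBPrinted_of_endpointExistence_of_logSlopeLower`: K1⁹'s body at `(θ, h, v)` — route text after `∃ θ h v,`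
VERBATIM — gives (B) at the revised datum, END through K2⁹ `endpointGivenRunRowsR13SepCoPHV_holds`, and the coupling comparability (H_cmp) through ITS OWN ROW (iv) (§3 of the cone-free file,
`logCoupling_comparable_of_runPartialSumFloor`, `M′ = max(M,0)∕2`); the ONE displayed extra is the small-field floor (H_low): for each `g ∈ ]0,γ_c]` a `c(g) > 0` below the last-step small-field mass of every `γ_c`-windowed run ending at `g` (uniform in `K`).
READING FOR THE WITNESS LANES (`SU(2)`, `d(𝔤) = 3`): together with p641922, whatever tuple closes K1⁹ with K-uniform last-step small-field floors has per-step numerics slots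
growing like `a·log(1∕g_j)·|T^{(j)*}|` with `a` in the band `[3(1−4L⁻⁴)∕(4(1−L⁻⁴)), 3∕4]`; print's `z` of [I] (0.15) (`log z_j = d(𝔤) log g_j + O(1)`, two-sided in the tree) sits at `3∕4` exactly.
HONEST FRAMING: count-neutral; K1⁹ NEITHER proved NOR refuted (its `∃ θ` ranges over all slots; (H_low) is a hypothesis on the witness, not derived); nothing of Bałaban's asserted or refuted;
no skeleton ∕ route text changed; N13 NOT discharged; counts UNMOVED (typed 28∕28 · discharged 5∕27 · A 5∕28); R4 closes the conditional finite-𝕋⁴ rung `BalabanLadder.UV` only — the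
Yang–Mills mass gap (Clay) is NOT proved by any of this; nothing continuum ∕ ℝ⁴ ∕ OS.  No `sorry`, `def`, `instance`, `notation`.
-/

noncomputable section

open scoped BigOperators

namespace Summit.QuantumFields.YangMills.BalabanUVNodes.N13K1R9WitnessUpperSlopeThreshold

open Literature.MathematicalPhysics.QuantumFieldTheory.Balaban1983to89
open Literature.MathematicalPhysics.QuantumFieldTheory.Balaban1983to89.T4Continuum
open Literature.MathematicalPhysics.QuantumFieldTheory.Balaban1983to89.Node00
open T4StabilitySocket
open Summit.QuantumFields.YangMills.Theorems.BalabanUVNodesK2R9Holds (endpointGivenRunRowsR13SepCoPHV_holds)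
open Summit.QuantumFields.YangMills.BalabanUVNodes.N13NormalisationUpperSlopeThresholdAtRecord13SepCoPHV
  (false_of_endStatementBPrinted_of_endpointExistence_of_logSlopeLower logCoupling_comparable_of_runPartialSumFloor)

variable {F : T4Family}

/-- **★★★ K1⁹'s BODY IS FALSE AT EVERY TUPLE WITH SUPER-THRESHOLD NORMALISATION SLOPE AND A LAST-STEP SMALL-FIELD FLOOR.**  `a ≤ d(𝔤) < 4a`, `0 ≤ C_w`; slots with
`(a·(−log g_j) − C_w)·|T^{(j)*}| ≤ −logz_p(j)·(L⁴−1)|T₁^{(j+1)}| + Efl_p(j)` in the weak-coupling regime (`g_j = gOfRecord₁₃ θ p j`); the small-field mass of the revised datum at the last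
step of every run in SOME window `]0,γ_c]` ending at `g` bounded below by some `c(g) > 0` uniformly in `K`: then the text after `∃ θ h v,` of
`Summit.QuantumFields.YangMills.Theses.BalabanUVNodes.StabilityBRunRowsAtRecordR13SepCoPHV`, VERBATIM, implies `False` — (H_cmp) comes from row (iv) of the body itself (window `min(γ₀, γ_c, 1)`).
[cite: Balaban1988Convergent, Thm 1 p.262, (1.15) p.249, Cor. 3 (2.50) p.264; Balaban1987RG1, Thm 2 p.259, (0.15) p.254, (0.20) p.256] -/
theorem k1R9Body_false_of_logSlopeLower (θ : Stage13HParams F 2) (h : θ.Provisos₁₃SepCoPH F 2) (v : Revision₁₃ F 2 θ h) {a Cw γc : ℝ}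
    (ha : a ≤ ((dimSU 2 : ℕ) : ℝ)) (hκ : ((dimSU 2 : ℕ) : ℝ) < 4 * a) (hCw : 0 ≤ Cw) (hγc : 0 < γc)
    (hw : ∀ (p : B12.RunParams) (j : ℕ), j < p.K → 0 < gOfRecord₁₃ F 2 θ.toStage13Params p j → gOfRecord₁₃ F 2 θ.toStage13Params p j ≤ 1 →
      (a * (-Real.log (gOfRecord₁₃ F 2 θ.toStage13Params p j)) - Cw) * tstarCount (F.P p.K) j ≤
        -(θ.logz p j) * ((((F.P p.K).L : ℝ) ^ 4 - 1) * sitesCard (F.P p.K) (j + 1)) + θ.Efl p j)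
    (hlow : ∀ g : ℝ, 0 < g → g ≤ γc → ∃ c : ℝ, 0 < c ∧ ∀ (K : ℕ) (g₀ : ℝ),
      (∀ k, k ≤ K → 0 < gOfRecord₁₃ F 2 θ.toStage13Params ⟨K, F.m, g₀⟩ k ∧ gOfRecord₁₃ F 2 θ.toStage13Params ⟨K, F.m, g₀⟩ k ≤ γc) →
        gOfRecord₁₃ F 2 θ.toStage13Params ⟨K, F.m, g₀⟩ K = g → c ≤ smallFieldMass (datumOfRecord₁₃SepCoPHV F 2 θ h v) K g₀)
    (hbody : (θ.ZhUnity F 2 ∧ θ.SlotsNondegenerate₁₃ F 2) ∧ θ.Admissible F 2 ∧ B16.EndStatementBPrinted (Node00.datumOfRecord₁₃SepCoPHV F 2 θ h v).C ∧ (∃ γ₁ : ℝ, 0 < γ₁ ∧ ∀ γ : ℝ, 0 < γ → γ ≤ γ₁ → ∃ P : B12.RunParams, 1 ≤ P.K ∧ ((Node00.datumOfRecord₁₃SepCoPHV F 2 θ h v).C P).flow.InInterval γ P.K) ∧ ∃ (b : ℕ → ℝ) (r γ₀ M : ℝ), 0 < γ₀ ∧ (∀ (n : ℕ) (gs : ℕ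 → ℝ), FlowStep.RGEqH n (Node00.betaOfRecord₁₃ F 2 θ.toStage13Params) gs → Step.InInterval γ₀ n gs → ∀ k, k ≤ n → |Node00.betaOfRecord₁₃ F 2 θ.toStage13Params k (FlowStep.prefixOf gs k) - b k| ≤ r) ∧ (∀ (n : ℕ) (gs : ℕ → ℝ), FlowStep.RGEqH n (Node00.betaOfRecord₁₃ F 2 θ.toStage13Params) gs → Step.InInterval γ₀ n gs → ∀ k, k ≤ n → -M ≤ ∑ j ∈ Finset.Ico k n, Node00.betaOfRecord₁₃ F 2 θ.toStage13Params j (FlowStep.prefixOf gs j)) ∧ ∀ k : ℕ, ContinuousOn (fun x : ℝ => Node00.betaOfRecord₁₃ F 2 θ.toStage13Params k (FlowStep.clampPrefix (Node00.betaOfRecord₁₃ F 2 θ.toStage13Params) γ₀ k x)) {x : ℝ | 0 < x ∧ x ≤ γ₀ ∧ ∀ j, j ≤ k → 1 / γ₀ ^ 2 ≤ FlowStep.Y (Node00.betaOfRecord₁₃ F 2 θ.toStage13Params) γ₀ j x}) : False := by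
  obtain ⟨hU, hθ, hB, hwin, hrows⟩ := hbody
  obtain ⟨b, r, γ₀, M, hγ₀, -, hiv, -⟩ := id hrows
  -- the comparability window `γ' = min(γ₀, γ_c, 1)`
  set γ' : ℝ := min γ₀ (min γc 1) with hγ'
  have hγ'pos : 0 < γ' := lt_min hγ₀ (lt_min hγc one_pos)
  have hγ'₀ : γ' ≤ γ₀ := min_le_left _ _
  have hγ'c : γ' ≤ γc := (min_le_right _ _).trans (min_le_left _ _)
  have hγ'1 : γ' ≤ 1 := (min_le_right _ _).trans (min_le_right _ _)
  refine false_of_endStatementBPrinted_of_endpointExistence_of_logSlopeLower θ h v (M' := max M 0 / 2) ha hκ hCw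
    (by positivity) hγ'pos hw ?_ ?_ hB (endpointGivenRunRowsR13SepCoPHV_holds F θ h v hU hθ hB hrows hwin)
  · -- (H_cmp) from row (iv) on `γ'`-windowed runs
    intro p hp
    have hI : ((datumOfRecord₁₃SepCoPHV F 2 θ h v).C p).flow.InInterval γ' p.K := by
      intro k hk
      rw [flow_g_datumOfRecord₁₃SepCoPHV]
      exact hp k hk
    exact logCoupling_comparable_of_runPartialSumFloor θ h v hiv p hγ'₀ hγ'1 hI
  · -- (H_low) on `γ'`-windowed runs from the `γ_c`-windowed floor
    intro g hg hgle
    obtain ⟨c, hc, hcK⟩ := hlow g hg (hgle.trans hγ'c)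
    exact ⟨c, hc, fun K g₀ hp hK => hcK K g₀ (fun k hk => ⟨(hp k hk).1, (hp k hk).2.trans hγ'c⟩) hK⟩

/-- **READING FOR THE SUPPLIER LANES (`SU(2)`, `d(𝔤) = 3`)**: if K1⁹ holds then at every family with the K0⁷ antecedent, for EVERY `a` with `3 < 4a`, `a ≤ 3`, every `C_w ≥ 0`,
`γ_c > 0`: EITHER its witness's slots violate the slope-`a` LOWER bound at some weak-coupling step (`(a·log(1∕g_j) − C_w)|T^{(j)*}| > −logz_p(j)·(L⁴−1)|T₁^{(j+1)}| + Efl_p(j)`), OR at some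
renormalised coupling `g ∈ ]0,γ_c]` the last-step small-field masses of its `γ_c`-windowed runs ending at `g` have NO positive floor uniform in `K`.  CONDITIONAL on the crux; nothing asserted.
[cite: Balaban1988Convergent, Thm 1 p.262, (1.15) p.249, Cor. 3 (2.50) p.264; Balaban1987RG1, (0.15) p.254] -/
theorem k1R9Witness_slope_le_or_floor_fails (hK1 : Summit.QuantumFields.YangMills.Theses.BalabanUVNodes.StabilityBRunRowsAtRecordR13SepCoPHV) (F : T4Family)
    (h0 : ∃ θ : Stage13HParams F 2, θ.Provisos₁₃SepCoPH F 2 ∧ (θ.ZhUnity F 2 ∧ θ.SlotsNondegenerate₁₃ F 2) ∧ θ.Admissible F 2)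
    {a Cw γc : ℝ} (ha : a ≤ ((dimSU 2 : ℕ) : ℝ)) (hκ : ((dimSU 2 : ℕ) : ℝ) < 4 * a) (hCw : 0 ≤ Cw) (hγc : 0 < γc) :
    ∃ (θ : Stage13HParams F 2) (h : θ.Provisos₁₃SepCoPH F 2) (v : Revision₁₃ F 2 θ h),
      B16.EndStatementBPrinted (datumOfRecord₁₃SepCoPHV F 2 θ h v).C ∧
      ((∃ (p : B12.RunParams) (j : ℕ), j < p.K ∧ 0 < gOfRecord₁₃ F 2 θ.toStage13Params p j ∧ gOfRecord₁₃ F 2 θ.toStage13Params p j ≤ 1 ∧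
          -(θ.logz p j) * ((((F.P p.K).L : ℝ) ^ 4 - 1) * sitesCard (F.P p.K) (j + 1)) + θ.Efl p j <
            (a * (-Real.log (gOfRecord₁₃ F 2 θ.toStage13Params p j)) - Cw) * tstarCount (F.P p.K) j) ∨
        ∃ g : ℝ, 0 < g ∧ g ≤ γc ∧ ∀ c : ℝ, 0 < c → ∃ (K : ℕ) (g₀ : ℝ),
          (∀ k, k ≤ K → 0 < gOfRecord₁₃ F 2 θ.toStage13Params ⟨K, F.m, g₀⟩ k ∧ gOfRecord₁₃ F 2 θ.toStage13Params ⟨K, F.m, g₀⟩ k ≤ γc) ∧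
          gOfRecord₁₃ F 2 θ.toStage13Params ⟨K, F.m, g₀⟩ K = g ∧ smallFieldMass (datumOfRecord₁₃SepCoPHV F 2 θ h v) K g₀ < c) := by
  obtain ⟨θ, h, v, hbody⟩ := hK1 F h0
  refine ⟨θ, h, v, hbody.2.2.1, ?_⟩
  by_contra hno
  push Not at hno
  obtain ⟨hno1, hno2⟩ := hno
  exact k1R9Body_false_of_logSlopeLower θ h v ha hκ hCw hγc (fun p j hj h0' h1 => hno1 p j hj h0' h1)
    (fun g hg hgle => by
      obtain ⟨c, hc, hcK⟩ := hno2 g hg hgle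
      exact ⟨c, hc, fun K g₀ hp hK => hcK K g₀ hp hK⟩) hbody

end Summit.QuantumFields.YangMills.BalabanUVNodes.N13K1R9WitnessUpperSlopeThreshold

end
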